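import Summits.MatrixMultiplication.OmegaCensus.BoxBadS3S3Config

/-!
# ω-census, family (b3): conjecture C9 (b) — the `C₃² ⋊ C₄` CONFIGURATION (an order-`3` element commuting with its conjugate, squared conjugation inverting) is box-useless, ratio `≥ 2`

HONEST FRAMING (pub-omega census; verbatim): lottery ticket; floor = certified bounds/negative ranges.
Census BOOKKEEPING (conjecture C9 of the cell, STRUCTURE.md §2, prereg P-032.2 'C₃² ⋊ C₄ (faithful): α ≥ 72 by certificate';
pub-omega kernel-l4 gen 16, task K-5; second client of `BoxKeyLiftModel`).

**Theorem (`C3C3C4Config.not_boxUseful`).** Let `a, x ∈ G` with `a³ = 1 ≠ a`, `a` commuting with `b := x a x⁻¹`, and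
`x² a x⁻² = a⁻¹` (so `x` acts on `⟨a, b⟩ ≅ C₃²` by the order-`4` matrix `(p,q) ↦ (-q,p)`; NOTHING is assumed on the order of
`x` — `x⁴` merely centralises `⟨a,b⟩`).  Then `G` is NOT box-useful: the box `G × {1, a, b} × {1, x², ax}` carries `2|G|`
independent cells — key lift over `N = ⟨a, b⟩` with an `18`-element pattern (`18/9 = 2`) found by the seat's key-graph search,
checked by `decide` in the model `Multiplicative (ZMod 3)²`; the `81` gauge words by one simp normal form.
**Corollaries.** `C₃² ⋊ C₄` (order `36`, P-032.2 — now KERNEL with `α ≥ 72 = 2·36`), `C₃² ⋊ C₈`, `C₃² ⋊ Q₈`, `(C₃² ⋊ C₄) × A`,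
`PSU(3,2)`-type groups, … ; this is the endpoint configuration 'a `2`-element of order `4` on a minimal normal `C₃²`' of the
centreless branch of the non-nilpotent analysis.  Nothing here is progress on `ω`.
-/

namespace Summit.MatrixMultiplication.OmegaCensus

open Finset ProductBoxBound KeyLift KleinRot

namespace C3C3C4Config

/-- The coordinate model `M = C₃ × C₃` (multiplicative). [folklore] -/
abbrev M := Multiplicative (ZMod 3) × Multiplicative (ZMod 3)

/-- Coordinates `v p q = (a^p, b^q)` in the model. [folklore] -/
def v (p q : ZMod 3) : M := (Multiplicative.ofAdd p, Multiplicative.ofAdd q)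

/-- Conjugation by `x` in coordinates: `(p, q) ↦ (-q, p)`. [folklore] -/
def σx : M →* M where
  toFun m := (m.2⁻¹, m.1)
  map_one' := by decide
  map_mul' := by decide

/-- The inverse of `σx`: `(p, q) ↦ (q, -p)`. [folklore] -/
def τx : M → M := fun m => (m.2, m.1⁻¹)

/-- `τx` is a right inverse of `σx`. [folklore] -/
theorem σx_τx : ∀ m, σx (τx m) = m := by decide

/-- The gauge table of the box `{1, a, b} × {1, x², ax}` in coordinates (machine-generated from the model). [folklore] -/
def γ : Three → Three → Three → Three → M
  | .i0, .i0, .i0, .i0 => v 0 0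
  | .i0, .i0, .i0, .i1 => v 0 0
  | .i0, .i0, .i0, .i2 => v 0 0
  | .i0, .i0, .i1, .i0 => v 0 0
  | .i0, .i0, .i1, .i1 => v 1 0
  | .i0, .i0, .i1, .i2 => v 2 1
  | .i0, .i0, .i2, .i0 => v 0 0
  | .i0, .i0, .i2, .i1 => v 0 1
  | .i0, .i0, .i2, .i2 => v 2 2
  | .i0, .i1, .i0, .i0 => v 0 0
  | .i0, .i1, .i0, .i1 => v 0 0
  | .i0, .i1, .i0, .i2 => v 1 0
  | .i0, .i1, .i1, .i0 => v 0 0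
  | .i0, .i1, .i1, .i1 => v 1 0
  | .i0, .i1, .i1, .i2 => v 0 1
  | .i0, .i1, .i2, .i0 => v 0 0
  | .i0, .i1, .i2, .i1 => v 0 1
  | .i0, .i1, .i2, .i2 => v 0 2
  | .i0, .i2, .i0, .i0 => v 0 0
  | .i0, .i2, .i0, .i1 => v 2 0
  | .i0, .i2, .i0, .i2 => v 0 0
  | .i0, .i2, .i1, .i0 => v 0 0
  | .i0, .i2, .i1, .i1 => v 0 0
  | .i0, .i2, .i1, .i2 => v 2 1
  | .i0, .i2, .i2, .i0 => v 0 0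
  | .i0, .i2, .i2, .i1 => v 2 1
  | .i0, .i2, .i2, .i2 => v 2 2
  | .i1, .i0, .i0, .i0 => v 0 0
  | .i1, .i0, .i0, .i1 => v 2 0
  | .i1, .i0, .i0, .i2 => v 1 2
  | .i1, .i0, .i1, .i0 => v 0 0
  | .i1, .i0, .i1, .i1 => v 0 0
  | .i1, .i0, .i1, .i2 => v 0 0
  | .i1, .i0, .i2, .i0 => v 0 0
  | .i1, .i0, .i2, .i1 => v 2 1
  | .i1, .i0, .i2, .i2 => v 0 1
  | .i1, .i1, .i0, .i0 => v 0 0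
  | .i1, .i1, .i0, .i1 => v 2 0
  | .i1, .i1, .i0, .i2 => v 2 2
  | .i1, .i1, .i1, .i0 => v 0 0
  | .i1, .i1, .i1, .i1 => v 0 0
  | .i1, .i1, .i1, .i2 => v 1 0
  | .i1, .i1, .i2, .i0 => v 0 0
  | .i1, .i1, .i2, .i1 => v 2 1
  | .i1, .i1, .i2, .i2 => v 1 1
  | .i1, .i2, .i0, .i0 => v 0 0
  | .i1, .i2, .i0, .i1 => v 1 0
  | .i1, .i2, .i0, .i2 => v 1 2
  | .i1, .i2, .i1, .i0 => v 0 0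
  | .i1, .i2, .i1, .i1 => v 2 0
  | .i1, .i2, .i1, .i2 => v 0 0
  | .i1, .i2, .i2, .i0 => v 0 0
  | .i1, .i2, .i2, .i1 => v 1 1
  | .i1, .i2, .i2, .i2 => v 0 1
  | .i2, .i0, .i0, .i0 => v 0 0
  | .i2, .i0, .i0, .i1 => v 0 2
  | .i2, .i0, .i0, .i2 => v 1 1
  | .i2, .i0, .i1, .i0 => v 0 0
  | .i2, .i0, .i1, .i1 => v 1 2
  | .i2, .i0, .i1, .i2 => v 0 2
  | .i2, .i0, .i2, .i0 => v 0 0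
  | .i2, .i0, .i2, .i1 => v 0 0
  | .i2, .i0, .i2, .i2 => v 0 0
  | .i2, .i1, .i0, .i0 => v 0 0
  | .i2, .i1, .i0, .i1 => v 0 2
  | .i2, .i1, .i0, .i2 => v 2 1
  | .i2, .i1, .i1, .i0 => v 0 0
  | .i2, .i1, .i1, .i1 => v 1 2
  | .i2, .i1, .i1, .i2 => v 1 2
  | .i2, .i1, .i2, .i0 => v 0 0
  | .i2, .i1, .i2, .i1 => v 0 0
  | .i2, .i1, .i2, .i2 => v 1 0
  | .i2, .i2, .i0, .i0 => v 0 0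
  | .i2, .i2, .i0, .i1 => v 2 2
  | .i2, .i2, .i0, .i2 => v 1 1
  | .i2, .i2, .i1, .i0 => v 0 0
  | .i2, .i2, .i1, .i1 => v 0 2
  | .i2, .i2, .i1, .i2 => v 0 2
  | .i2, .i2, .i2, .i0 => v 0 0
  | .i2, .i2, .i2, .i1 => v 2 0
  | .i2, .i2, .i2, .i2 => v 0 0

/-- The `18`-element key pattern (machine-found; `18 = 2·|C₃²|`). [folklore] -/
def T₀ : Finset (M × Three × Three) :=
  {(v 0 0, .i0, .i0), (v 1 2, .i0, .i0), (v 2 1, .i0, .i0), (v 0 1, .i0, .i1), (v 1 0, .i0, .i1), (v 2 2, .i0, .i1), (v 0 1, .i1, .i1), (v 1 0, .i1, .i1), (v 2 2, .i1, .i1), (v 0 1, .i1, .i2), (v 1 0, .i1, .i2), (v 2 2, .i1, .i2), (v 0 2, .i2, .i0), (v 1 1, .i2, .i0), (v 2 0, .i2, .i0), (v 0 1, .i2, .i2), (v 1 0, .i2, .i2), (v 2 2, .i2, .i2)}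

/-- The pattern is independent in the model key graph. [folklore] -/
theorem T₀_key : ∀ t ∈ T₀, ∀ t' ∈ T₀, t ≠ t' → t.1 ≠ γ t.2.1 t.2.2 t'.2.1 t'.2.2 * t'.1 := by decide

/-- `#T₀ = 18`. [folklore] -/
theorem T₀_card : #T₀ = 18 := by decide

open S3S3Config (val0 val1 val2 inv_eq_sq)

variable {G : Type*} [Group G] {a x : G}

/-- `g² = 1` and `g³ = 1` force `g = 1`. [folklore] -/
theorem eq_one_of_sq {g : G} (hg : g ^ 3 = 1) (h2 : g ^ 2 = 1) : g = 1 := by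
  calc g = g ^ 3 * (g ^ 2)⁻¹ := by group
    _ = 1 := by rw [hg, h2]; group

section Main

variable (ha : a ^ 3 = 1) (hcomm : a * (x * a * x⁻¹) = (x * a * x⁻¹) * a) (hx2 : x * x * a * x⁻¹ * x⁻¹ = a⁻¹)

/-- `b := x a x⁻¹` has `b³ = 1`. [folklore] -/
theorem hb3 (ha : a ^ 3 = 1) : (x * a * x⁻¹) ^ 3 = 1 := by
  have e : (x * a * x⁻¹) ^ 3 = x * a ^ 3 * x⁻¹ := by
    simp only [pow_succ, pow_zero, one_mul, mul_assoc, inv_mul_cancel_left]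
  rw [e, ha]; group

/-- The coordinate homomorphism `ψ (p, q) = a^p b^q`. [folklore] -/
def ψ (ha : a ^ 3 = 1) (hcomm : a * (x * a * x⁻¹) = (x * a * x⁻¹) * a) : M →* G :=
  MonoidHom.noncommCoprod (cycHom 3 a ha) (cycHom 3 (x * a * x⁻¹) (hb3 ha)) (fun m n => by
    rw [cycHom_apply, cycHom_apply]
    exact (Commute.pow_pow hcomm _ _))

/-- `ψ (v p q) = a ^ p.val * b ^ q.val`. [folklore] -/
theorem ψ_v (p q : ZMod 3) : ψ ha hcomm (v p q) = a ^ p.val * (x * a * x⁻¹) ^ q.val := by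
  simp [ψ, v, MonoidHom.noncommCoprod_apply, cycHom_ofAdd]

/-- A homomorphism out of `M` agreeing with another on `(ofAdd 1, 1)` and `(1, ofAdd 1)` is equal to it. [folklore] -/
theorem hom_ext {f g : M →* G} (h₁ : f (Multiplicative.ofAdd 1, 1) = g (Multiplicative.ofAdd 1, 1))
    (h₂ : f (1, Multiplicative.ofAdd 1) = g (1, Multiplicative.ofAdd 1)) : f = g := by
  refine prod_ext (fun p => ?_) (fun q => ?_)
  · have e := mzmod_ext (f := f.comp (MonoidHom.inl _ _)) (g := g.comp (MonoidHom.inl _ _)) (by simpa using h₁)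
    simpa using congrArg (fun φ : Multiplicative (ZMod 3) →* G => φ p) e
  · have e := mzmod_ext (f := f.comp (MonoidHom.inr _ _)) (g := g.comp (MonoidHom.inr _ _)) (by simpa using h₂)
    simpa using congrArg (fun φ : Multiplicative (ZMod 3) →* G => φ q) e

/-- `ψ` on the two generators. [folklore] -/
theorem ψ_gen : ψ ha hcomm (Multiplicative.ofAdd 1, 1) = a ∧ ψ ha hcomm (1, Multiplicative.ofAdd 1) = x * a * x⁻¹ := by
  constructor
  · have := ψ_v ha hcomm 1 0
    simpa [v, val1] using this
  · have := ψ_v ha hcomm 0 1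
    simpa [v, val1] using this

include hx2 in
/-- Conjugation by `x` in coordinates: `x ψ(p,q) x⁻¹ = ψ(-q, p)`. [folklore] -/
theorem conj_x (m : M) : x * ψ ha hcomm m * x⁻¹ = ψ ha hcomm (σx m) := by
  obtain ⟨g1, g2⟩ := ψ_gen ha hcomm
  refine conj_of_hom_eq (hom_ext ?_ ?_) m
  · have e2 : σx (Multiplicative.ofAdd (1 : ZMod 3), 1) = v 0 1 := by decide
    simp only [MonoidHom.comp_apply, MulEquiv.coe_toMonoidHom, MulAut.conj_apply, g1, e2, ψ_v, val0, val1, pow_zero,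
      pow_one, one_mul]
  · have e2 : σx (1, Multiplicative.ofAdd (1 : ZMod 3)) = v 2 0 := by decide
    simp only [MonoidHom.comp_apply, MulEquiv.coe_toMonoidHom, MulAut.conj_apply, g2, e2, ψ_v, val0, val2, pow_zero,
      mul_one]
    rw [← inv_eq_sq ha, ← hx2]; group

end Main

section Final

variable (ha : a ^ 3 = 1) (hcomm : a * (x * a * x⁻¹) = (x * a * x⁻¹) * a) (hx2 : x * x * a * x⁻¹ * x⁻¹ = a⁻¹)

include hx2 in
/-- `ψ` is injective when `a ≠ 1` (the conjugate `b` is then independent of `a`). [folklore] -/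
theorem ψ_injective (ha1 : a ≠ 1) : Function.Injective (ψ ha hcomm) := by
  have hb := hb3 (x := x) ha
  set b := x * a * x⁻¹ with hbdef
  have hxb : x * b * x⁻¹ = a⁻¹ := by rw [hbdef, ← hx2]; group
  -- `b ∉ {1, a, a²}`
  have ha2 : a ^ 2 ≠ 1 := fun h => ha1 (eq_one_of_sq ha h)
  have hb1 : b ≠ 1 := by
    intro h; apply ha1
    have : a⁻¹ = 1 := by rw [← hxb, h]; group
    exact inv_eq_one.mp this
  have hba : b ≠ a := by
    intro h; apply ha2
    -- `x a x⁻¹ = a` and `x b x⁻¹ = a⁻¹` with `b = a` give `a = a⁻¹`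
    have e : a = a⁻¹ := by rw [← hxb, h, ← hbdef, h]
    rw [pow_two]; nth_rw 2 [e]; exact mul_inv_cancel a
  have hba2 : b ≠ a ^ 2 := by
    intro h; apply ha2
    -- `b = a² = a⁻¹`: then `x b x⁻¹ = (x a x⁻¹)⁻¹ = b⁻¹ = a`, but it is `a⁻¹`
    have e1 : b = a⁻¹ := by rw [h, inv_eq_sq ha]
    have e2 : x * b * x⁻¹ = a := by
      rw [e1, show x * a⁻¹ * x⁻¹ = (x * a * x⁻¹)⁻¹ by group, ← hbdef, e1, inv_inv]
    rw [hxb] at e2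
    -- `e2 : a⁻¹ = a`
    rw [pow_two]; nth_rw 1 [← e2]; exact inv_mul_cancel a
  have key : ∀ i j : ℕ, i < 3 → j < 3 → a ^ i * b ^ j = 1 → i = 0 ∧ j = 0 := by
    intro i j hi hj h
    interval_cases i <;> interval_cases j
    all_goals try simp only [pow_zero, pow_one, one_mul, mul_one] at h
    · exact ⟨rfl, rfl⟩
    · exact absurd h hb1
    · exact absurd (eq_one_of_sq hb h) hb1
    · exact absurd h ha1
    · -- `a b = 1 ⇒ b = a⁻¹ = a²`
      exact absurd ((eq_inv_of_mul_eq_one_right h).trans (inv_eq_sq ha)) hba2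
    · -- `a b² = 1 ⇒ a = b⁻² = b`
      exfalso; apply hba
      calc b = b ^ 3 * (b ^ 2)⁻¹ := by group
        _ = (b ^ 2)⁻¹ := by rw [hb, one_mul]
        _ = a := (eq_inv_of_mul_eq_one_left h).symm
    · exact absurd h ha2
    · -- `a² b = 1 ⇒ b = a⁻² = a`
      exfalso; apply hba
      calc b = (a ^ 2)⁻¹ := eq_inv_of_mul_eq_one_right h
        _ = a ^ 3 * (a ^ 2)⁻¹ := by rw [ha, one_mul]
        _ = a := by group
    · -- `a² b² = 1 ⇒ (ab)² = 1 ⇒ ab = 1`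
      exfalso
      have hab3 : (a * b) ^ 3 = 1 := by
        rw [(show Commute a b from hcomm).mul_pow, ha, hb, one_mul]
      have hab2 : (a * b) ^ 2 = 1 := by
        rw [(show Commute a b from hcomm).mul_pow]; exact h
      have hab1 : a * b = 1 := eq_one_of_sq hab3 hab2
      exact hba2 ((eq_inv_of_mul_eq_one_right hab1).trans (inv_eq_sq ha))
  rw [injective_iff_map_eq_one]
  rintro ⟨p, q⟩ h
  have h' : a ^ (Multiplicative.toAdd p).val * b ^ (Multiplicative.toAdd q).val = 1 := by
    rw [hbdef]
    simpa only [ψ, MonoidHom.noncommCoprod_apply, cycHom_apply] using h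
  obtain ⟨hp, hq⟩ := key _ _ (ZMod.val_lt _) (ZMod.val_lt _) h'
  have hp' : Multiplicative.toAdd p = 0 := (ZMod.val_eq_zero _).1 hp
  have hq' : Multiplicative.toAdd q = 0 := (ZMod.val_eq_zero _).1 hq
  rw [show p = 1 from toAdd_eq_zero.mp hp', show q = 1 from toAdd_eq_zero.mp hq']; rfl

/-- The second box coordinate `Y = {1, a, b}`. [folklore] -/
def yv (φ : M →* G) : Three → G
  | .i0 => 1 | .i1 => φ (v 1 0) | .i2 => φ (v 0 1)

/-- The third box coordinate `W = {1, x², ax}`. [folklore] -/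
def wv (φ : M →* G) (x : G) : Three → G
  | .i0 => 1 | .i1 => x * x | .i2 => φ (v 1 0) * x

include ha hcomm hx2 in
/-- **The `C₃² ⋊ C₄` configuration makes `G` box-useless (ratio `≥ 2`).** [folklore] -/
theorem not_boxUseful [Fintype G] [DecidableEq G] (ha1 : a ≠ 1) : ¬ BoxUseful G := by
  classical
  have hinj : Function.Injective (ψ ha hcomm) := ψ_injective ha hcomm hx2 ha1
  have ga : ψ ha hcomm (v 1 0) = a := by rw [ψ_v]; simp [val1]
  have gb : ψ ha hcomm (v 0 1) = x * a * x⁻¹ := by rw [ψ_v]; simp [val1]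
  have g0 : ψ ha hcomm (v 0 0) = 1 := by rw [ψ_v]; simp
  have Rx := conj_rule (conj_x ha hcomm hx2)
  have Rx' := conj_rule' (conj_x ha hcomm hx2)
  have Rxi := conj_rule_inv (conj_x ha hcomm hx2) σx_τx
  have Rxi' := conj_rule_inv' (conj_x ha hcomm hx2) σx_τx
  -- distinctness in the box
  have ha2 : a ^ 2 ≠ 1 := fun h => ha1 (eq_one_of_sq ha h)
  have hb1 : x * a * x⁻¹ ≠ 1 := by
    intro h; apply ha1
    calc a = x⁻¹ * (x * a * x⁻¹) * x := by group
      _ = 1 := by rw [h]; group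
  have hab : a ≠ x * a * x⁻¹ := by
    intro h
    have := hinj (ga.trans (h.trans gb.symm))
    exact absurd this (by decide)
  have hxx1 : x * x ≠ 1 := by
    intro h; apply ha2
    have hii : x⁻¹ * x⁻¹ = 1 := by rw [← mul_inv_rev, h, inv_one]
    have e : a = a⁻¹ := by
      calc a = x * x * a * (x⁻¹ * x⁻¹) := by rw [h, hii]; group
        _ = x * x * a * x⁻¹ * x⁻¹ := by group
        _ = a⁻¹ := hx2
    rw [pow_two]; nth_rw 2 [e]; exact mul_inv_cancel a
  have hax1 : a * x ≠ 1 := by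
    intro h
    -- `x = a⁻¹` commutes with `a`, so `x a x⁻¹ = a`, contradicting `a ≠ b`
    apply hab
    have hx : x = a⁻¹ := eq_inv_of_mul_eq_one_right h
    rw [hx]; group
  have haxx : x * x ≠ a * x := by
    intro h
    have hx : x = a := mul_right_cancel h
    apply hab; rw [hx]; group
  have hy_inj : Function.Injective (yv (ψ ha hcomm)) := by
    intro i j h
    cases i <;> cases j <;> simp only [yv, ga, gb] at h
    all_goals first | rfl | exfalso
    all_goals first | exact ha1 h.symm | exact ha1 h | exact hb1 h.symm | exact hb1 h | exact hab h | exact hab h.symm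
  have hw_inj : Function.Injective (wv (ψ ha hcomm) x) := by
    intro i j h
    cases i <;> cases j <;> simp only [wv, ga] at h
    all_goals first | rfl | exfalso
    all_goals first | exact hxx1 h.symm | exact hxx1 h | exact hax1 h.symm | exact hax1 h | exact haxx h | exact haxx h.symm
  have hM : 9 * Fintype.card M ≤ 5 * #T₀ := by
    rw [T₀_card]; simp [M, Fintype.card_prod, ZMod.card]
  refine not_boxUseful_of_model (ψ ha hcomm) hinj (yv (ψ ha hcomm)) (wv (ψ ha hcomm) x) hy_inj hw_inj rfl rfl
    γ ?_ T₀ T₀_key hM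
  intro i j i' j'
  cases i <;> cases j <;> cases i' <;> cases j' <;>
  · simp only [yv, wv, γ, gaugeWord, mul_assoc, mul_inv_rev, inv_one, one_mul, mul_one, psi_mul_left, psi_mul,
      psi_inv, Rx, Rx', Rxi, Rxi', mul_inv_cancel_left, mul_inv_cancel, map_one]
    first | exact g0.symm | (apply congrArg (ψ ha hcomm); decide)

end Final

end C3C3C4Config

end Summit.MatrixMultiplication.OmegaCensus
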